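import Literature.NumberTheory.Automorphic.ArthurClozelBaseChange
import Literature.NumberTheory.Automorphic.NormGroupClosedProofs
import Literature.NumberTheory.GaloisRepresentations.ArtinCharacterReciprocityProofs
import HarnessLib

/-!
# The class-field character of a cyclic extension exists: `exists_isClassFieldCharacter` holds

Topic `NumberTheory/Automorphic`; namespace `Literature.NumberTheory.Automorphic`. Proof file
(theorems only: no definition, no named fact, no instance). It **discharges the named fact
`exists_isClassFieldCharacter`** of `ArthurClozelBaseChange` — the class-field-theoretic input of
Arthur–Clozel, Ch. 3 §4 ("`η` a character of `𝔸^*` vanishing exactly on `F^* N(𝔸_E^*)`"): *for a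
cyclic extension `E/F` of number fields there is a Hecke character `η` of `F` with
`η(x) = 1 ↔ x ∈ Fˣ N(𝔸_Eˣ)` and of order `[E : F]`* — i.e. Tate's Main Theorem (B) of global class
field theory (Cassels–Fröhlich, Ch. VII §5.1: the Artin map `J_K → G(L/K)` is surjective with
kernel `K^* N_{L/K} J_L`) for cyclic `L/K`, composed with a faithful character of the cyclic
group `J_K / K^* N_{L/K} J_L ≅ G(L/K)`.

## Proof (assembly of the tree's class field theory)

Write `n = [E : F]`, `N = Fˣ N(𝔸_Eˣ) = normGroup F E ≤ 𝕀_F`, `𝔪` for the admissible modulus of `E/F`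
(`IdeleHerbrand.admissibleModulus`, supported on the ramified primes) and `W = W_𝔪` for the
congruence ideles (`congruenceIdeles 𝔪`). Everything below is already proved in the tree; this
file only assembles it.

1. **`[𝕀_F : N] = n` and `𝕀_F / N` is cyclic.** Let `χ₀ : Gal(E/F) ↪ ℂˣ` be a faithful character
   and `𝒜 = artinHom (χ₀ ∘ Frob)` the Artin homomorphism on fractional ideals
   (Childress, Ch. 5 §2). On `W`, `ψ = 𝒜 ∘ (w ↦ (w))` (`IdeleHerbrand.idealOfIdele`, with values in
   `ℐ_F(𝔪)`) has `ker ψ ≤ N ∩ W`: by **Artin's kernel crossing** `ker 𝒜 ∩ ℐ_F(𝔪) ≤ 𝒫⁺_{F,𝔪} 𝒩(𝔪)`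
   (`ker_artinHom_inf_idealsPrimeTo_le_ray_sup_normSubgroup`, Childress Ch. 5 Prop. 2.2) and the
   idèle/ideal dictionary `(w) ∈ 𝒫⁺𝒩 ⇒ w ∈ N` (`IdeleHerbrand.mem_normGroup_of_idealOfIdele_mem`,
   Childress Ch. 4 §3, §5 Thm. 5.12). Hence `[𝕀_F : N] = [W : N ∩ W]` (weak approximation
   `𝕀_F = Fˣ W`, `IdeleHerbrand.index_normGroup_eq_relIndex`) divides `[W : ker ψ] = #ψ(W) ≤ #Gal = n`,
   while the **idelic first inequality** `n ∣ [𝕀_F : N] ≠ 0`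
   (`IdeleHerbrand.card_dvd_index_normGroup_of_isCyclic`, Childress Thm. 5.11–5.12 = Tate §8–§9)
   gives the reverse; and `𝕀_F / N` is a quotient of `W / ker ψ ↪ ℂˣ`, a finite subgroup of the
   units of a field, hence cyclic.
2. **`N` is open**: it is closed (`isClosed_normGroup`, Neukirch, Bonn Lectures III (7.8)) of
   finite index.
3. A faithful character `χ` of the cyclic group `𝕀_F / N` of order `n` gives
   `η = χ ∘ (𝕀_F → 𝕀_F/N)`: continuous (its kernel `N` is open), trivial on `Fˣ ≤ N`, with
   `η(x) = 1 ↔ x ∈ N` and `ηᵏ = 1 ↔ n ∣ k`, so `ord η = n`.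

## Main statement

* `exists_isClassFieldCharacter_holds : exists_isClassFieldCharacter (F := F) (E := E)`.

Auxiliary (proved, reusable): `index_normGroup_eq_finrank_of_isCyclic` (**the idelic norm index
equality `[𝕀_F : Fˣ N_{E/F} 𝕀_E] = [E : F]` for cyclic `E/F`**, Tate §5.1 (B) at the level of
indices), `isCyclic_quotient_normGroup` (`𝕀_F / Fˣ N_{E/F} 𝕀_E` is cyclic), `isOpen_normGroup`.

## References

* J. W. S. Cassels, A. Fröhlich (eds.), *Algebraic Number Theory* (1967), Ch. VII (J. Tate,
  *Global class field theory*), §5.1 Main Theorem (B); §8–§10. [CasselsFrohlichANT1967]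
* N. Childress, *Class Field Theory*, Universitext, Springer 2009, Ch. 4 §3, §5 Thm. 5.11–5.12;
  Ch. 5 §2 Thm. 2.1, Prop. 2.2. [Childress2009]
* J. Neukirch, *Class Field Theory — The Bonn Lectures*, Springer 2013, Part III (7.8). [Neukirch2013]
* J. Arthur, L. Clozel, *Simple algebras, base change, and the advanced theory of the trace
  formula*, Ann. of Math. Stud. 120 (1989), Ch. 3 §4 (the character `η`). [ArthurClozelAMS120]
-/

noncomputable section

namespace Literature.NumberTheory.Automorphic

open _root_.NumberField _root_.IsDedekindDomain
open Literature.NumberTheory.GaloisRepresentations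
open scoped nonZeroDivisors

variable {F E : Type} [Field F] [NumberField F] [Field E] [NumberField E] [Algebra F E]
  [FiniteDimensional F E]

/-- **The norm index of a cyclic extension and the cyclicity of `𝕀_F / Fˣ N_{E/F} 𝕀_E`** (Tate's
Main Theorem (B), Cassels–Fröhlich Ch. VII §5.1, at the level of the quotient group, for `E/F`
cyclic): `[𝕀_F : Fˣ N_{E/F} 𝕀_E] = [E : F]` and `𝕀_F / Fˣ N_{E/F} 𝕀_E` is cyclic. Proof: Artin's
kernel crossing bounds the index above by `[E : F]` and exhibits the quotient as a homomorphic
image of a finite subgroup of `ℂˣ`; the idelic first inequality bounds it below.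
[cite: CasselsFrohlichANT1967, Ch. VII §5.1 Main Theorem (B)] -/
theorem index_normGroup_eq_finrank_and_isCyclic [IsGalois F E] [IsCyclic (E ≃ₐ[F] E)] :
    (normGroup F E).index = Module.finrank F E ∧ IsCyclic (ideleGroup F ⧸ normGroup F E) := by
  classical
  obtain ⟨σ, hσ⟩ := IsCyclic.exists_generator (α := E ≃ₐ[F] E)
  set 𝔪 : Ideal (𝓞 F) := IdeleHerbrand.admissibleModulus F E with h𝔪def
  have h𝔪 : 𝔪 ≠ ⊥ := IdeleHerbrand.admissibleModulus_ne_bot F E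
  have hram : ∀ v : HeightOneSpectrum (𝓞 F), ¬ 𝔪 ≤ v.asIdeal → Algebra.IsUnramifiedIn (𝓞 E) v.asIdeal :=
    fun v hv => not_not.mp fun h => hv ((IdeleHerbrand.admissibleModulus_le_iff (E := E) v).mpr h)
  set W : Subgroup (ideleGroup F) := congruenceIdeles 𝔪 with hWdef
  -- a faithful character of the Galois group and its Artin homomorphism on `W`
  obtain ⟨χ₀, hχ₀⟩ := exists_monoidHom_units_complex_injective (E ≃ₐ[F] E)
  set 𝒜 : (FractionalIdeal (𝓞 F)⁰ F)ˣ →* ℂˣ := artinHom fun v => χ₀ (galFrob F E v) with h𝒜def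
  set ΦW : W →* (FractionalIdeal (𝓞 F)⁰ F)ˣ := (IdeleHerbrand.idealOfIdele F).comp W.subtype with hΦWdef
  set ψ : W →* ℂˣ := 𝒜.comp ΦW with hψdef
  have hψ_apply : ∀ w : W, ψ w = 𝒜 (IdeleHerbrand.idealOfIdele F (w : ideleGroup F)) := fun w => rfl
  -- (1) `ker ψ ≤ N ∩ W`, `N = normGroup F E` (Artin's kernel crossing + the idèle/ideal dictionary)
  have hker : ψ.ker ≤ (normGroup F E).subgroupOf W := by
    rintro ⟨w, hw⟩ hwk
    rw [MonoidHom.mem_ker, hψ_apply] at hwk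
    rw [Subgroup.mem_subgroupOf]
    have hI : IdeleHerbrand.idealOfIdele F w ∈ idealsPrimeTo 𝔪 :=
      IdeleHerbrand.idealOfIdele_mem_idealsPrimeTo h𝔪 hw
    have hAk : IdeleHerbrand.idealOfIdele F w ∈ 𝒜.ker ⊓ idealsPrimeTo 𝔪 :=
      Subgroup.mem_inf.mpr ⟨MonoidHom.mem_ker.mpr hwk, hI⟩
    exact IdeleHerbrand.mem_normGroup_of_idealOfIdele_mem hσ hw
      (ker_artinHom_inf_idealsPrimeTo_le_ray_sup_normSubgroup hχ₀ h𝔪 hram hAk)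
  -- (2) `[W : ker ψ] = #ψ(W) ≤ #Gal(E/F) = n`, and it is finite (nonzero)
  have hrange : ψ.range ≤ χ₀.range := by
    rintro _ ⟨w, rfl⟩
    rw [hψ_apply]
    exact artinHom_mem_of_forall_mem (fun v => MonoidHom.mem_range.mpr ⟨galFrob F E v, rfl⟩) _
  haveI : Finite χ₀.range := Set.finite_range χ₀ |>.to_subtype
  have hcardG : Nat.card (E ≃ₐ[F] E) = Module.finrank F E := IsGalois.card_aut_eq_finrank F E
  have hψidx : ψ.ker.index = Nat.card ψ.range := Subgroup.index_ker ψ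
  have hψle : ψ.ker.index ≤ Module.finrank F E := by
    rw [hψidx, ← hcardG]
    calc Nat.card ψ.range ≤ Nat.card χ₀.range := Nat.card_mono (Set.toFinite _) hrange
      _ ≤ Nat.card (E ≃ₐ[F] E) :=
        Nat.card_le_card_of_surjective _ (MonoidHom.rangeRestrict_surjective χ₀)
  have hψne : ψ.ker.index ≠ 0 := by
    rw [hψidx]
    haveI : Finite ψ.range := Finite.Set.subset (χ₀.range : Set ℂˣ) hrange
    exact Nat.card_pos.ne'
  -- (3) `[𝕀_F : N] = n`: `[𝕀_F : N] = [W : N ∩ W] ∣ [W : ker ψ] ≤ n` and `n ∣ [𝕀_F : N] ≠ 0`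
  have hNW : (normGroup F E).index = ((normGroup F E).subgroupOf W).index := by
    rw [IdeleHerbrand.index_normGroup_eq_relIndex (F := F) (E := E), Subgroup.relIndex,
      Subgroup.inf_subgroupOf_right]
  have hNle : (normGroup F E).index ≤ Module.finrank F E := by
    rw [hNW]
    exact (Nat.le_of_dvd (Nat.pos_of_ne_zero hψne) (Subgroup.index_dvd_of_le hker)).trans hψle
  obtain ⟨hndvd, hN0⟩ := IdeleHerbrand.card_dvd_index_normGroup_of_isCyclic (F := F) (E := E) hσ
  rw [← Nat.card_eq_fintype_card, hcardG] at hndvd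
  have hNidx : (normGroup F E).index = Module.finrank F E :=
    le_antisymm hNle (Nat.le_of_dvd (Nat.pos_of_ne_zero hN0) hndvd)
  refine ⟨hNidx, ?_⟩
  -- (4) `𝕀_F / N` is a quotient of `W / ker ψ ↪ ℂˣ` (as `𝕀_F = Fˣ W`, `Fˣ ≤ N`), hence cyclic
  haveI : ψ.ker.FiniteIndex := ⟨hψne⟩
  haveI : IsCyclic (W ⧸ ψ.ker) :=
    isCyclic_of_injective_ringHom ((Units.coeHom ℂ).comp (QuotientGroup.kerLift ψ))
      (Units.val_injective.comp (QuotientGroup.kerLift_injective ψ))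
  set π : W →* ideleGroup F ⧸ normGroup F E := (QuotientGroup.mk' (normGroup F E)).comp W.subtype with hπdef
  have hπ_apply : ∀ w : W, π w = QuotientGroup.mk (w : ideleGroup F) := fun w => rfl
  have hπsurj : Function.Surjective π := by
    intro q
    obtain ⟨x, rfl⟩ := QuotientGroup.mk_surjective q
    obtain ⟨a, ha⟩ := exists_principalIdele_mul_mem_congruenceIdeles h𝔪 x
    refine ⟨⟨_, ha⟩, ?_⟩
    rw [hπ_apply, QuotientGroup.mk_mul,
      (QuotientGroup.eq_one_iff _).mpr (principalIdeles_le_normGroup F E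
        (_root_.Literature.NumberTheory.GaloisRepresentations.principalIdele_mem a))]
    exact (one_mul (M := ideleGroup F ⧸ normGroup F E) _)
  have hkerπ : ψ.ker ≤ π.ker := by
    intro w hw
    rw [MonoidHom.mem_ker, hπ_apply, QuotientGroup.eq_one_iff]
    exact hker hw
  exact isCyclic_of_surjective (QuotientGroup.lift ψ.ker π hkerπ)
    (QuotientGroup.lift_surjective_of_surjective ψ.ker π hπsurj hkerπ)

/-- **The idelic norm index equality** `[𝕀_F : Fˣ N_{E/F} 𝕀_E] = [E : F]` for a cyclic extension
`E/F` of number fields. [cite: CasselsFrohlichANT1967, Ch. VII §5.1 Main Theorem (B)] -/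
theorem index_normGroup_eq_finrank_of_isCyclic [IsGalois F E] [IsCyclic (E ≃ₐ[F] E)] :
    (normGroup F E).index = Module.finrank F E :=
  index_normGroup_eq_finrank_and_isCyclic.1

/-- **`𝕀_F / Fˣ N_{E/F} 𝕀_E` is cyclic** for `E/F` cyclic. [cite: CasselsFrohlichANT1967, Ch. VII §5.1 Main Theorem (B)] -/
theorem isCyclic_quotient_normGroup [IsGalois F E] [IsCyclic (E ≃ₐ[F] E)] :
    IsCyclic (ideleGroup F ⧸ normGroup F E) :=
  index_normGroup_eq_finrank_and_isCyclic.2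

/-- **The norm group of a cyclic extension is open** in `𝕀_F` (closed of finite index).
[cite: Neukirch2013, Part III (7.8)] -/
theorem isOpen_normGroup [IsGalois F E] [IsCyclic (E ≃ₐ[F] E)] :
    IsOpen (normGroup F E : Set (ideleGroup F)) := by
  haveI : (normGroup F E).FiniteIndex := ⟨by
    rw [index_normGroup_eq_finrank_of_isCyclic (F := F) (E := E)]; exact Module.finrank_pos.ne'⟩
  exact Subgroup.isOpen_of_isClosed_of_finiteIndex _ (isClosed_normGroup F E)

/-- **Existence of the class-field character of a cyclic extension** (discharge of the named fact
`exists_isClassFieldCharacter`; Cassels–Fröhlich, Ch. VII (Tate) §5.1 Main Theorem (B) for cyclic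
`E/F`, composed with a faithful character of the cyclic group `𝕀_F / Fˣ N_{E/F} 𝕀_E` of order
`[E : F]`): there is a Hecke character `η` of `F` with `η(x) = 1 ↔ x ∈ Fˣ N(𝔸_Eˣ)`, of order
`[E : F]`. [cite: CasselsFrohlichANT1967, Ch. VII §5.1 Main Theorem (B)] -/
theorem exists_isClassFieldCharacter_holds : exists_isClassFieldCharacter (F := F) (E := E) := by
  intro _ _
  classical
  obtain ⟨hNidx, hcyc⟩ := index_normGroup_eq_finrank_and_isCyclic (F := F) (E := E)
  haveI := hcyc
  haveI : (normGroup F E).FiniteIndex := ⟨by rw [hNidx]; exact Module.finrank_pos.ne'⟩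
  have hQcard : Nat.card (ideleGroup F ⧸ normGroup F E) = Module.finrank F E := by
    rw [← Subgroup.index_eq_card, hNidx]
  -- a faithful character of the cyclic quotient `𝕀_F / Fˣ N(𝔸_Eˣ)`
  obtain ⟨χ, hχ⟩ := exists_monoidHom_units_complex_injective (ideleGroup F ⧸ normGroup F E)
  set η₀ : ideleGroup F →* ℂˣ := χ.comp (QuotientGroup.mk' (normGroup F E)) with hη₀def
  have hη₀ : ∀ x, η₀ x = χ (QuotientGroup.mk x) := fun x => rfl
  have hη₀_eq_one : ∀ x, η₀ x = 1 ↔ x ∈ normGroup F E := fun x => by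
    rw [hη₀, ← map_one χ, hχ.eq_iff, QuotientGroup.eq_one_iff]
  -- continuity: the kernel is the open subgroup `N`
  have hNopen : IsOpen (normGroup F E : Set (ideleGroup F)) := isOpen_normGroup (F := F) (E := E)
  have hcont : Continuous η₀ := by
    refine continuous_of_continuousAt_one η₀ ?_
    rw [ContinuousAt, map_one]
    refine Filter.tendsto_def.mpr fun U hU =>
      Filter.mem_of_superset (hNopen.mem_nhds (normGroup F E).one_mem) fun x hx => ?_
    rw [Set.mem_preimage, (hη₀_eq_one x).mpr hx]
    exact mem_of_mem_nhds hU
  set η : HeckeCharacter F :=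
    { toContinuousMonoidHom := { η₀ with continuous_toFun := hcont }
      map_principal' := fun x hx => (hη₀_eq_one x).mpr (principalIdeles_le_normGroup F E hx) }
    with hηdef
  have hηx : ∀ x, η x = η₀ x := fun x => rfl
  refine ⟨η, ?_, ?_⟩
  · -- `η` vanishes exactly on the norm group
    intro x
    rw [hηx]
    exact hη₀_eq_one x
  · -- the order: `η ^ k = 1 ↔ n ∣ k`
    have hpow : ∀ k : ℕ, η ^ k = 1 ↔ Module.finrank F E ∣ k := by
      intro k
      rw [← hQcard, ← IsCyclic.exponent_eq_card, Monoid.exponent_dvd_iff_forall_pow_eq_one]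
      constructor
      · intro h q
        obtain ⟨x, rfl⟩ := QuotientGroup.mk_surjective q
        have hx : (η ^ k) x = 1 := by rw [h, HeckeCharacter.one_apply]
        rw [HeckeCharacter.pow_apply, hηx, hη₀, ← map_pow, ← map_one χ, hχ.eq_iff] at hx
        exact hx
      · intro h
        ext x
        rw [HeckeCharacter.pow_apply, hηx, hη₀, ← map_pow, h, map_one, HeckeCharacter.one_apply]
    exact Nat.dvd_antisymm (orderOf_dvd_of_pow_eq_one ((hpow _).mpr dvd_rfl))
      ((hpow _).mp (pow_orderOf_eq_one η))

end Literature.NumberTheory.Automorphic
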